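import Summits.QuantumFields.BalabanUV.Beta.GAN24.WoodburyFibreLandauBox
import Literature.MathematicalPhysics.QuantumFieldTheory.Balaban1983to89.Beta.AffineAveraging

/-!
# Beta / GAN24 / WoodburyFibreLandauLimit — census row V10, part 1: the tools that carry the Neumann-box theorem of
`GAN24/WoodburyFibreLandauBox` to the infinite lattice `ℤ^{d+1}` — pointwise subsequential limits of bounded kernels, the
lattice bi-Laplacian at interior points of a box, and the KKT identities of the box Landau operator

Cell `pub-balaban`, β sub-cell, BINDER ROW **G-an2-4 ∕ (CONV-C)** («NOT IN PRINT; our proof attempt»), prover part **P3 =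
WOODBURY-FIBRE reduction** (lineage `b2b-balaban-gan24-p3`, gen 6).  HONEST FRAMING (verbatim): discharging `BetaPertH`
makes Bałaban's UV stability UNCONDITIONAL — a real constructive-QFT result; it is NOT the continuum limit and NOT the Clay
problem.  HONEST DEPENDENCY: continuum YM on T⁴ ⇐ BetaPertH ∧ nine spine estimates (0/9 proved); BetaPertH ⇐ (D1) ∧ (D4) ∧
CAP+tail; G-an2-4 gates asym, D1 and NE2/3/4.  `[folklore]`; 0 sorry; nothing printed and nothing programme-internal is used
as a hypothesis; nothing of (CONV-C) ∕ `BetaPertH` is discharged here.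

## Contents
* §1 `exists_subseq_pointwise_limit` (Tychonoff + first countability of countable products): a sequence of real kernels on a
  countable index set with pointwise bounds `|f n i| ≤ B i` has a pointwise-convergent subsequence with a limit obeying the same
  bounds; `abs_le_of_tendsto`; `finsum_eq_of_tendsto` (finite linear relations pass to pointwise limits).
* §2 the lattice Laplacian of `Beta/AffineAveraging` (`codiff₁ ∘ dz`, an2's `L`) in stencil form (`lap_apply`), its locality
  (`lap_congr`), homogeneity (`lap_smul`), and **`boxLap_interior`** ∕ **`boxLapSq_interior`**: at a point whose
  `2`-neighbourhood lies inside the box, the Neumann box operator `boxOpR n 0 0 M` (resp. its square) acts on a vector as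
  `n²·L` (resp. `n⁴·L∘L`) acts on its extension by zero.
* §3 the KKT identities of the box Landau operator `Γ = flucCov (L_n·L_n + SᵀS) S` in kernel form: `(L_n·L_n·Γ)(x,x′) +
  (comultiplier)(blk x, x′) = δ_{xx′}` (`landau_kkt_entry`) and `Σ_{blk z = y} Γ(z, x′) = 0` (`landau_blockSum_zero`), plus the
  invertibility facts used (`isUnit_landauForm`, `isUnit_landauPivot`).
* §4 the re-centred cubes `[−Rn, Rn)^{d+1}` (`cubeM`, `shiftF`, `shiftB`, `blk_add_shiftF`) and eventual interiority of `2`-neighbourhoods and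
  blocks (`eventually_two_nbhd`, `eventually_block`).
Part 2 (`GAN24/WoodburyFibreLandauZd`) runs the limit along growing boxes and identifies it with an2's `BiLaplaceBlockKKT.Sb`.
-/

namespace Summit.QuantumFields.BalabanUV.Beta.GAN24.WoodburyFibreLandauLimit

open Filter Topology Finset Matrix
open Literature.MathematicalPhysics.QuantumFieldTheory.Balaban1983to89
open B4ContourShift (supNorm supNorm_nonneg abs_le_supNorm)
open B4Reflection242 (boxDom mem_boxDom blk nbrs mem_nbrs supNorm_le_of_forall)
open B4Green242Bridge (boxNbrs)
open B4BoxCov237 (boxOpR opBoxR indB extB extB_of_mem extB_of_not_mem opBoxR_mulVec boxOpR_isUnit)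
open Beta.AffineAveraging (dz codiff₁ unitVec box toSite)
open Summit.QuantumFields.BalabanUV.Beta.PropagatorWoodburyFibre (pivot flucCov comultiplier form_mul_flucCov
  constraint_mul_flucCov)
open WoodburyFibreBoxQGQ (fineN blkBox blkBox_val indB_apply)
open WoodburyFibreGaugeInputs (Qn sN sN_pos reg_eq mul_indBT_apply)
open WoodburyFibreGaugeBox (isUnit_biForm isUnit_pivot_biForm)

noncomputable section

variable {d : ℕ}

/-! ## §1 Pointwise subsequential limits of bounded kernels -/

/-- **pointwise subsequential limits of bounded kernels**: if `|f n i| ≤ B i` for all `n, i` (countable index set) then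
some subsequence converges pointwise to a `g` with `|g i| ≤ B i`. [folklore] -/
theorem exists_subseq_pointwise_limit {ι : Type*} [Countable ι] (f : ℕ → ι → ℝ) (B : ι → ℝ)
    (hf : ∀ n i, |f n i| ≤ B i) :
    ∃ g : ι → ℝ, ∃ φ : ℕ → ℕ, StrictMono φ ∧ (∀ i, Tendsto (fun n => f (φ n) i) atTop (𝓝 (g i))) ∧ ∀ i, |g i| ≤ B i := by
  set s : Set (ι → ℝ) := Set.pi Set.univ fun i => Set.Icc (-B i) (B i) with hs
  have hsc : IsCompact s := isCompact_univ_pi fun i => isCompact_Icc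
  have hmem : ∀ n, f n ∈ s := fun n => by
    simp only [hs, Set.mem_pi, Set.mem_univ, true_implies, Set.mem_Icc]
    exact fun i => abs_le.1 (hf n i)
  obtain ⟨g, hg, φ, hφ, hlim⟩ := hsc.tendsto_subseq hmem
  refine ⟨g, φ, hφ, fun i => ?_, fun i => ?_⟩
  · exact (tendsto_pi_nhds.1 hlim) i
  · simp only [hs, Set.mem_pi, Set.mem_univ, true_implies, Set.mem_Icc] at hg
    exact abs_le.2 (hg i)

/-- a pointwise limit inherits pointwise bounds. [folklore] -/
theorem abs_le_of_tendsto {f : ℕ → ℝ} {x c : ℝ} (h : Tendsto f atTop (𝓝 x)) (hb : ∀ n, |f n| ≤ c) : |x| ≤ c :=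
  le_of_tendsto' ((continuous_abs.tendsto x).comp h) hb

/-- finite linear relations pass to pointwise limits (the right-hand sides need only be eventually known). [folklore] -/
theorem finsum_eq_of_tendsto {ι : Type*} {f : ℕ → ι → ℝ} {g : ι → ℝ} (S : Finset ι) (a : ι → ℝ)
    (hlim : ∀ i, Tendsto (fun n => f n i) atTop (𝓝 (g i))) {r : ℕ → ℝ} {r0 : ℝ} (hr : Tendsto r atTop (𝓝 r0))
    (heq : ∀ᶠ n in atTop, ∑ j ∈ S, a j * f n j = r n) : ∑ j ∈ S, a j * g j = r0 := by
  have h1 : Tendsto (fun n => ∑ j ∈ S, a j * f n j) atTop (𝓝 (∑ j ∈ S, a j * g j)) :=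
    tendsto_finsetSum S fun j _ => (hlim j).const_mul (a j)
  exact tendsto_nhds_unique (h1.congr' heq) hr

/-! ## §2 The lattice Laplacian `L = codiff₁ ∘ dz` in stencil form, and the Neumann box operator at interior points -/

/-- **stencil form**: `(L f)(x) = Σ_μ (2 f(x) − f(x + e_μ) − f(x − e_μ))`. [folklore] -/
theorem lap_apply (f : (Fin (d + 1) → ℤ) → ℝ) (x : Fin (d + 1) → ℤ) :
    codiff₁ (dz f) x = ∑ μ, (2 * f x - f (x + Pi.single μ 1) - f (x - Pi.single μ 1)) := by
  simp only [codiff₁, dz, unitVec, sub_add_cancel]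
  exact Finset.sum_congr rfl fun μ _ => by ring

/-- homogeneity. [folklore] -/
theorem lap_smul (c : ℝ) (f : (Fin (d + 1) → ℤ) → ℝ) (x : Fin (d + 1) → ℤ) :
    codiff₁ (dz (fun z => c * f z)) x = c * codiff₁ (dz f) x := by
  rw [lap_apply, lap_apply, Finset.mul_sum]
  exact Finset.sum_congr rfl fun μ _ => by ring

/-- locality: `(L f)(x)` only reads `f` on `x` and its nearest neighbours. [folklore] -/
theorem lap_congr {f g : (Fin (d + 1) → ℤ) → ℝ} {x : Fin (d + 1) → ℤ} (hx : f x = g x)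
    (h : ∀ z ∈ nbrs x, f z = g z) : codiff₁ (dz f) x = codiff₁ (dz g) x := by
  rw [lap_apply, lap_apply]
  refine Finset.sum_congr rfl fun μ _ => ?_
  rw [hx, h _ (mem_nbrs.2 ⟨μ, Or.inl rfl⟩), h _ (mem_nbrs.2 ⟨μ, Or.inr rfl⟩)]

/-- the real version of `B4Green242Bridge.sum_nbrs`. [folklore] -/
theorem sum_nbrs_real (φ : (Fin (d + 1) → ℤ) → ℝ) (x : Fin (d + 1) → ℤ) :
    ∑ z ∈ nbrs x, φ z = ∑ μ, φ (x + Pi.single μ 1) + ∑ μ, φ (x - Pi.single μ 1) := by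
  have h := B4Green242Bridge.sum_nbrs (fun z => (φ z : ℂ)) x
  exact_mod_cast h

/-- the stencil form via the neighbour set: `(L f)(x) = Σ_{z ∈ nbrs x} (f x − f z)`. [folklore] -/
theorem lap_eq_sum_nbrs (f : (Fin (d + 1) → ℤ) → ℝ) (x : Fin (d + 1) → ℤ) :
    codiff₁ (dz f) x = ∑ z ∈ nbrs x, (f x - f z) := by
  rw [sum_nbrs_real, lap_apply, ← Finset.sum_add_distrib]
  exact Finset.sum_congr rfl fun μ _ => by ring

/-- a sum over the in-box neighbours is the sum over all lattice neighbours when these lie in the box. [folklore] -/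
theorem sum_boxNbrs_eq {N : Fin (d + 1) → ℕ} (x : ↥(boxDom N)) (hint : ∀ z ∈ nbrs x.1, z ∈ boxDom N)
    (g : (Fin (d + 1) → ℤ) → ℝ) : ∑ y ∈ boxNbrs N x, g y.1 = ∑ z ∈ nbrs x.1, g z := by
  classical
  have himg : (boxNbrs N x).image Subtype.val = nbrs x.1 := by
    ext z
    simp only [boxNbrs, Finset.mem_image, Finset.mem_filter, Finset.mem_univ, true_and]
    constructor
    · rintro ⟨y, hy, rfl⟩; exact hy
    · intro hz; exact ⟨⟨z, hint z hz⟩, hz, rfl⟩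
  rw [← himg, Finset.sum_image fun y _ y' _ h => Subtype.ext h]

/-- `|L f(x)| ≤ 4(d+1)·B` when `|f| ≤ B`. [folklore] -/
theorem abs_lap_le {f : (Fin (d + 1) → ℤ) → ℝ} {B : ℝ} (x : Fin (d + 1) → ℤ) (hB : ∀ z, |f z| ≤ B) :
    |codiff₁ (dz f) x| ≤ 4 * ((d : ℝ) + 1) * B := by
  rw [lap_apply]
  have hterm : ∀ μ : Fin (d + 1), |2 * f x - f (x + Pi.single μ 1) - f (x - Pi.single μ 1)| ≤ 4 * B := by
    intro μ
    have h1 := hB x; have h2 := hB (x + Pi.single μ 1); have h3 := hB (x - Pi.single μ 1)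
    have e1 : |2 * f x - f (x + Pi.single μ 1) - f (x - Pi.single μ 1)|
        ≤ |2 * f x - f (x + Pi.single μ 1)| + |f (x - Pi.single μ 1)| := abs_sub _ _
    have e2 : |2 * f x - f (x + Pi.single μ 1)| ≤ |2 * f x| + |f (x + Pi.single μ 1)| := abs_sub _ _
    rw [abs_mul, abs_two] at e2
    linarith
  calc |∑ μ : Fin (d + 1), (2 * f x - f (x + Pi.single μ 1) - f (x - Pi.single μ 1))|
      ≤ ∑ μ : Fin (d + 1), |2 * f x - f (x + Pi.single μ 1) - f (x - Pi.single μ 1)| := Finset.abs_sum_le_sum_abs _ _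
    _ ≤ ∑ _μ : Fin (d + 1), 4 * B := Finset.sum_le_sum fun μ _ => hterm μ
    _ = 4 * ((d : ℝ) + 1) * B := by
        rw [Finset.sum_const, Finset.card_univ, Fintype.card_fin, nsmul_eq_mul]; push_cast; ring

/-- sup-norm of a unit vector. [folklore] -/
theorem supNorm_single (i : Fin (d + 1)) : supNorm (Pi.single i (1 : ℤ)) ≤ 1 := by
  refine supNorm_le_of_forall fun j => ?_
  by_cases h : j = i
  · subst h; simp
  · simp [h]

/-- a nearest neighbour is at sup-distance `≤ 1`. [folklore] -/
theorem supNorm_sub_le_one_of_mem_nbrs {x z : Fin (d + 1) → ℤ} (hz : z ∈ nbrs x) : supNorm (z - x) ≤ 1 := by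
  obtain ⟨i, hi | hi⟩ := mem_nbrs.1 hz
  · rw [hi, add_sub_cancel_left]; exact supNorm_single i
  · rw [hi, sub_sub_cancel_left, B4TorusKernel.supNorm_neg]; exact supNorm_single i

/-- the `2`-neighbourhood condition implies the point and its neighbours, and their neighbours, lie in the box. [folklore] -/
theorem mem_of_two_nbhd {N : Fin (d + 1) → ℕ} {x : Fin (d + 1) → ℤ} (h2 : ∀ z, supNorm (z - x) ≤ 2 → z ∈ boxDom N) :
    x ∈ boxDom N ∧ (∀ z ∈ nbrs x, z ∈ boxDom N) ∧ ∀ z ∈ nbrs x, ∀ z' ∈ nbrs z, z' ∈ boxDom N := by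
  refine ⟨h2 x ?_, fun z hz => h2 z ((supNorm_sub_le_one_of_mem_nbrs hz).trans (by norm_num)), fun z hz z' hz' => h2 z' ?_⟩
  · rw [sub_self]; exact supNorm_le_of_forall fun j => by simp
  · have := B4Thm110ZeroBox.supNorm_sub_le_sub_add_sub z' z x
    linarith [supNorm_sub_le_one_of_mem_nbrs hz, supNorm_sub_le_one_of_mem_nbrs hz']

/-- **THE NEUMANN BOX LAPLACIAN AT AN INTERIOR POINT**: if all lattice neighbours of `x` lie in the box, the box operator
`opBoxR c₁ 0 0 b N` acts on `v` at `x` as `c₁·L` on the extension of `v` by zero. [folklore] -/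
theorem boxLap_interior {N : Fin (d + 1) → ℕ} (c₁ : ℝ) (b : ℕ) (v : ↥(boxDom N) → ℝ) (x : ↥(boxDom N))
    (hint : ∀ z ∈ nbrs x.1, z ∈ boxDom N) :
    (opBoxR c₁ 0 0 b N *ᵥ v) x = c₁ * codiff₁ (dz (extB N v)) x.1 := by
  rw [opBoxR_mulVec, zero_mul, zero_mul, add_zero, add_zero, lap_eq_sum_nbrs]
  congr 1
  rw [← sum_boxNbrs_eq x hint (fun z => extB N v x.1 - extB N v z)]
  refine Finset.sum_congr rfl fun y _ => ?_
  rw [extB_of_mem v x.2, extB_of_mem v y.2]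

/-- **THE SQUARED NEUMANN BOX LAPLACIAN AT A `2`-INTERIOR POINT**: `((L_n·L_n)v)(x) = n⁴·(L(L ṽ))(x)`, `ṽ` the extension
of `v` by zero, `L_n = boxOpR n 0 0 M = n²(−Δ^N_X)`. [folklore] -/
theorem boxLapSq_interior {n : ℕ} {M : Fin (d + 1) → ℕ} (v : ↥(boxDom (fineN n M)) → ℝ) (x : ↥(boxDom (fineN n M)))
    (h2 : ∀ z, supNorm (z - x.1) ≤ 2 → z ∈ boxDom (fineN n M)) :
    ((boxOpR n 0 0 M * boxOpR n 0 0 M) *ᵥ v) x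
      = (n : ℝ) ^ 4 * codiff₁ (dz (codiff₁ (dz (extB (fineN n M) v)))) x.1 := by
  obtain ⟨-, h1, h1'⟩ := mem_of_two_nbhd h2
  have hL : boxOpR n 0 0 M = opBoxR ((n : ℝ) ^ 2) 0 0 n (fineN n M) := by
    simp only [boxOpR, zero_mul]
  rw [← Matrix.mulVec_mulVec, hL, boxLap_interior _ _ _ x h1]
  have hcongr : codiff₁ (dz (extB (fineN n M) (opBoxR ((n : ℝ) ^ 2) 0 0 n (fineN n M) *ᵥ v))) x.1
      = codiff₁ (dz (fun z => (n : ℝ) ^ 2 * codiff₁ (dz (extB (fineN n M) v)) z)) x.1 := by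
    refine lap_congr ?_ fun z hz => ?_
    · rw [extB_of_mem _ x.2, boxLap_interior _ _ _ x h1]
    · rw [extB_of_mem _ (h1 z hz), boxLap_interior _ _ _ ⟨z, h1 z hz⟩ (h1' z hz)]
  rw [hcongr, lap_smul]
  ring

/-- translation invariance of the lattice Laplacian. [folklore] -/
theorem lap_translate (f : (Fin (d + 1) → ℤ) → ℝ) (t x : Fin (d + 1) → ℤ) :
    codiff₁ (dz (fun z => f (z + t))) x = codiff₁ (dz f) (x + t) := by
  rw [lap_apply, lap_apply]
  refine Finset.sum_congr rfl fun μ _ => ?_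
  rw [add_right_comm x _ t, sub_add_eq_add_sub x _ t]

/-- the lattice Laplacian is continuous under pointwise convergence. [folklore] -/
theorem tendsto_lap {f : ℕ → (Fin (d + 1) → ℤ) → ℝ} {g : (Fin (d + 1) → ℤ) → ℝ}
    (h : ∀ z, Tendsto (fun R => f R z) atTop (𝓝 (g z))) (x : Fin (d + 1) → ℤ) :
    Tendsto (fun R => codiff₁ (dz (f R)) x) atTop (𝓝 (codiff₁ (dz g) x)) := by
  simp_rw [lap_apply]
  exact tendsto_finsetSum _ fun μ _ => (((h x).const_mul 2).sub (h _)).sub (h _)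

/-- a column of a matrix as a vector: `(A *ᵥ (B · j)) i = (A·B) i j`. [folklore] -/
theorem mulVec_col {p q r : Type*} [Fintype q] (A : Matrix p q ℝ) (B : Matrix q r ℝ) (i : p) (j : r) :
    (A *ᵥ fun w => B w j) i = (A * B) i j := by
  simp [Matrix.mulVec, Matrix.mul_apply, dotProduct]
/-- `|extB v z| = extB |v| z`. [folklore] -/
theorem abs_extB {N : Fin (d + 1) → ℕ} (v : ↥(boxDom N) → ℝ) (z : Fin (d + 1) → ℤ) :
    |extB N v z| = extB N (fun w => |v w|) z := by
  by_cases hz : z ∈ boxDom N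
  · rw [extB_of_mem _ hz, extB_of_mem _ hz]
  · rw [extB_of_not_mem _ hz, extB_of_not_mem _ hz, abs_zero]

/-! ## §3 The box Landau operator: KKT identities in kernel form, invertibility -/

/-- the regularised bi-form `L_n·L_n + SᵀS` of the box Landau operator (`L_n = boxOpR n 0 0 M`, `S = indB n M`; the
regulariser weight `1` is immaterial, `GAN24/WoodburyFibreLandauBox.landau_box_cubeDecay_indB`). [folklore] -/
def landauOp (n : ℕ) (M : Fin (d + 1) → ℕ) : Matrix ↥(boxDom (fineN n M)) ↥(boxDom (fineN n M)) ℝ :=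
  boxOpR n 0 0 M * boxOpR n 0 0 M + (1 : ℝ) • ((indB n M)ᵀ * indB n M)

/-- **the box Landau operator** `Γ = flucCov (L_n·L_n + SᵀS) S`: the block-constrained inverse of the squared Neumann
Laplacian. [folklore] -/
def landauCov (n : ℕ) (M : Fin (d + 1) → ℕ) : Matrix ↥(boxDom (fineN n M)) ↥(boxDom (fineN n M)) ℝ :=
  flucCov (landauOp n M) (indB n M)

/-- its block multiplier rows `comultiplier (L_n·L_n + SᵀS) S`. [folklore] -/
def landauCo (n : ℕ) (M : Fin (d + 1) → ℕ) : Matrix ↥(boxDom M) ↥(boxDom (fineN n M)) ℝ :=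
  comultiplier (landauOp n M) (indB n M)

/-- `pivot H (t·Q) = t²·pivot H Q` (real). [folklore] -/
theorem pivot_smul_real {p q : Type*} [Fintype p] [Fintype q] [DecidableEq p] [DecidableEq q] (H : Matrix q q ℝ)
    (Q : Matrix p q ℝ) (t : ℝ) : pivot H (t • Q) = (t * t) • pivot H Q := by
  simp only [pivot, Matrix.conjTranspose_smul, star_trivial, Matrix.smul_mul, Matrix.mul_smul, smul_smul]

/-- a nonzero scalar multiple of a unit matrix is a unit. [folklore] -/
theorem isUnit_smul_of_ne_zero {p : Type*} [Fintype p] [DecidableEq p] {A : Matrix p p ℝ} {t : ℝ} (ht : t ≠ 0)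
    (hA : IsUnit A) : IsUnit (t • A) := by
  rw [Matrix.isUnit_iff_isUnit_det, Matrix.det_smul]
  exact ((isUnit_iff_ne_zero.2 ht).pow _).mul ((Matrix.isUnit_iff_isUnit_det A).1 hA)

/-- the bi-form is the `c = n^{d+1}` instance of `L·L + Qnᴴ(c·1)Qn`. [folklore] -/
theorem landauOp_eq {n : ℕ} (hn : 1 ≤ n) (M : Fin (d + 1) → ℕ) : landauOp n M
    = boxOpR n 0 0 M * boxOpR n 0 0 M + (Qn n M)ᴴ * (((n : ℝ) ^ (d + 1)) • (1 : Matrix ↥(boxDom M) ↥(boxDom M) ℝ))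
      * Qn n M := by
  have hn0 : (0 : ℝ) < n := by exact_mod_cast hn
  have hN : ((n : ℝ) ^ (d + 1)) ≠ 0 := by positivity
  rw [landauOp, reg_eq M hn, mul_inv_cancel₀ hN]

/-- the bi-form is a unit. [folklore] -/
theorem isUnit_landauOp {n : ℕ} (hn : 1 ≤ n) (M : Fin (d + 1) → ℕ) (hM : ∀ i, 1 ≤ M i) : IsUnit (landauOp n M) := by
  have hn0 : (0 : ℝ) < n := by exact_mod_cast hn
  rw [landauOp_eq hn M]
  exact isUnit_biForm hn M hM le_rfl (by positivity)

/-- the pivot `S·(L·L + SᵀS)⁻¹·Sᵀ` is a unit. [folklore] -/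
theorem isUnit_landauPivot {n : ℕ} (hn : 1 ≤ n) (M : Fin (d + 1) → ℕ) (hM : ∀ i, 1 ≤ M i) : IsUnit (pivot (landauOp n M) (indB n M)) := by
  have hn0 : (0 : ℝ) < n := by exact_mod_cast hn
  have hs : (sN d n)⁻¹ ≠ 0 := inv_ne_zero (sN_pos (d := d) hn).ne'
  have hQ : indB n M = (sN d n)⁻¹ • Qn n M := by
    rw [Qn, smul_smul, inv_mul_cancel₀ (sN_pos (d := d) hn).ne', one_smul]
  rw [hQ, pivot_smul_real, landauOp_eq hn M]
  exact isUnit_smul_of_ne_zero (mul_ne_zero hs hs) (isUnit_pivot_biForm hn M hM le_rfl (by positivity))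

/-- **KKT, FIRST ROW, IN KERNEL FORM**: `(L_n·L_n·Γ)(x, x′) + C(blk x, x′) = δ_{x x′}`. [folklore] -/
theorem landau_kkt_entry {n : ℕ} (hn : 1 ≤ n) (M : Fin (d + 1) → ℕ) (hM : ∀ i, 1 ≤ M i) (x x' : ↥(boxDom (fineN n M))) :
    (boxOpR n 0 0 M * boxOpR n 0 0 M * landauCov n M) x x' + landauCo n M (blkBox hn M x) x'
      = if x = x' then 1 else 0 := by
  have hB := isUnit_landauOp hn M hM
  have hP := isUnit_landauPivot hn M hM
  have hid : landauOp n M * landauCov n M = 1 - (indB n M)ᵀ * landauCo n M := form_mul_flucCov hB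
  have hSΓ : indB n M * landauCov n M = 0 := constraint_mul_flucCov hP
  have hLL : boxOpR n 0 0 M * boxOpR n 0 0 M * landauCov n M = 1 - (indB n M)ᵀ * landauCo n M := by
    rw [← hid, landauOp, Matrix.add_mul, Matrix.smul_mul, Matrix.mul_assoc (indB n M)ᵀ, hSΓ, Matrix.mul_zero,
      smul_zero, add_zero]
  have hSC : ((indB n M)ᵀ * landauCo n M) x x' = landauCo n M (blkBox hn M x) x' := by
    rw [Matrix.mul_apply]
    have : ∀ b : ↥(boxDom M), (indB n M)ᵀ x b * landauCo n M b x' = if b = blkBox hn M x then landauCo n M b x' else 0 := by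
      intro b; rw [Matrix.transpose_apply, indB_apply hn]
      by_cases h : blkBox hn M x = b
      · subst h; simp
      · have h' : b ≠ blkBox hn M x := fun e => h e.symm
        simp [h, h']
    simp_rw [this]
    rw [Finset.sum_ite_eq' Finset.univ (blkBox hn M x), if_pos (Finset.mem_univ _)]
  rw [hLL, Matrix.sub_apply, hSC, Matrix.one_apply]
  ring

/-- **KKT, SECOND ROW**: the columns of `Γ` have zero block sums, `Σ_{blk z = y} Γ(z, x′) = 0`. [folklore] -/
theorem landau_blockSum_zero {n : ℕ} (hn : 1 ≤ n) (M : Fin (d + 1) → ℕ) (hM : ∀ i, 1 ≤ M i) (y : ↥(boxDom M)) (x' : ↥(boxDom (fineN n M))) :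
    ∑ z ∈ Finset.univ.filter (fun z => blkBox hn M z = y), landauCov n M z x' = 0 := by
  have hSΓ : indB n M * landauCov n M = 0 := constraint_mul_flucCov (isUnit_landauPivot hn M hM)
  have h := congrFun (congrFun hSΓ y) x'
  rw [Matrix.mul_apply, Matrix.zero_apply] at h
  rw [Finset.sum_filter]
  refine Eq.trans (Finset.sum_congr rfl fun z _ => ?_) h
  rw [indB_apply hn]
  split_ifs <;> simp

/-! ## §4 Re-centred Neumann boxes `[−Rn, Rn)^{d+1}` and eventual interiority (used by `WoodburyFibreLandauZd`) -/

/-- the unit box of `2R` blocks per side. [folklore] -/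
abbrev cubeM (d R : ℕ) : Fin (d + 1) → ℕ := fun _ => 2 * R
/-- the block-compatible re-centring shift `Rn·𝟙` of fine sites. [folklore] -/
def shiftF (d n R : ℕ) : Fin (d + 1) → ℤ := fun _ => (R : ℤ) * n
/-- the corresponding shift `R·𝟙` of block labels. [folklore] -/
def shiftB (d R : ℕ) : Fin (d + 1) → ℤ := fun _ => (R : ℤ)

/-- the shift moves block labels by `R·𝟙`. [folklore] -/
theorem blk_add_shiftF {n : ℕ} (hn : 1 ≤ n) (R : ℕ) (x : Fin (d + 1) → ℤ) :
    blk n (x + shiftF d n R) = blk n x + shiftB d R := by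
  have hn0 : (n : ℤ) ≠ 0 := by exact_mod_cast (by omega : n ≠ 0)
  funext i
  simp only [blk, shiftF, shiftB, Pi.add_apply]
  rw [Int.add_mul_ediv_right _ _ hn0]

/-- membership in the fine cube `[0, 2Rn)^{d+1}`. [folklore] -/
theorem mem_fineCube_iff {n R : ℕ} {z : Fin (d + 1) → ℤ} :
    z ∈ boxDom (fineN n (cubeM d R)) ↔ ∀ i, 0 ≤ z i ∧ z i < 2 * (R : ℤ) * n := by
  rw [mem_boxDom]
  refine forall_congr' fun i => ?_
  simp only [fineN, cubeM]; push_cast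
  constructor
  · rintro ⟨h0, h1⟩; exact ⟨h0, by linarith⟩
  · rintro ⟨h0, h1⟩; exact ⟨h0, by linarith⟩

/-- **eventual `2`-interiority**: for fixed `x`, for all large `R` the whole sup-`2`-neighbourhood of `x` lies, after the
shift, inside the fine cube `[0, 2Rn)^{d+1}`. [folklore] -/
theorem eventually_two_nbhd {n : ℕ} (hn : 1 ≤ n) (x : Fin (d + 1) → ℤ) :
    ∃ R₀ : ℕ, ∀ R, R₀ ≤ R → ∀ z, supNorm (z - x) ≤ 2 → z + shiftF d n R ∈ boxDom (fineN n (cubeM d R)) := by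
  refine ⟨(Finset.univ.sup fun i => (x i).natAbs) + 3, fun R hR z hz => ?_⟩
  rw [mem_fineCube_iff]
  intro i
  have hxi : (x i).natAbs ≤ Finset.univ.sup fun i => (x i).natAbs := Finset.le_sup (f := fun i => (x i).natAbs) (mem_univ i)
  have h1 : (((|(z - x) i| : ℤ)) : ℝ) ≤ supNorm (z - x) := abs_le_supNorm (z - x) i
  have h2 : |z i - x i| ≤ 2 := by
    have : (((|(z - x) i| : ℤ)) : ℝ) ≤ 2 := h1.trans hz
    rw [Pi.sub_apply] at this
    exact_mod_cast this
  have h3 : ((x i).natAbs : ℤ) = |x i| := Int.natCast_natAbs (x i)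
  have hR' : ((Finset.univ.sup fun i => (x i).natAbs : ℕ) : ℤ) + 3 ≤ R := by exact_mod_cast hR
  have hn1 : (1 : ℤ) ≤ n := by exact_mod_cast hn
  have hxabs : |x i| ≤ (Finset.univ.sup fun i => (x i).natAbs : ℕ) := by rw [← h3]; exact_mod_cast hxi
  simp only [shiftF, Pi.add_apply]
  have habs := abs_le.1 h2
  have hxab := abs_le.1 hxabs
  constructor <;> nlinarith

/-- **eventual interiority of a block**: for fixed `y`, for all large `R` the shifted block label lies in the unit cube and
every fine point of the block lies, after the shift, in the fine cube. [folklore] -/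
theorem eventually_block {n : ℕ} (hn : 1 ≤ n) (y : Fin (d + 1) → ℤ) :
    ∃ R₀ : ℕ, ∀ R, R₀ ≤ R → (y + shiftB d R ∈ boxDom (cubeM d R)) ∧
      ∀ b ∈ box (d + 1) n, (n : ℤ) • y + toSite b + shiftF d n R ∈ boxDom (fineN n (cubeM d R)) := by
  refine ⟨(Finset.univ.sup fun i => (y i).natAbs) + 1, fun R hR => ⟨?_, fun b hb => ?_⟩⟩
  · rw [mem_boxDom]
    intro i
    have hyi : (y i).natAbs ≤ Finset.univ.sup fun i => (y i).natAbs := Finset.le_sup (f := fun i => (y i).natAbs) (mem_univ i)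
    have h3 : ((y i).natAbs : ℤ) = |y i| := Int.natCast_natAbs (y i)
    have hyabs : |y i| ≤ (Finset.univ.sup fun i => (y i).natAbs : ℕ) := by rw [← h3]; exact_mod_cast hyi
    have hR' : ((Finset.univ.sup fun i => (y i).natAbs : ℕ) : ℤ) + 1 ≤ R := by exact_mod_cast hR
    have hyab := abs_le.1 hyabs
    simp only [shiftB, cubeM, Pi.add_apply]; push_cast
    constructor <;> linarith
  · rw [mem_fineCube_iff]
    intro i
    have hyi : (y i).natAbs ≤ Finset.univ.sup fun i => (y i).natAbs := Finset.le_sup (f := fun i => (y i).natAbs) (mem_univ i)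
    have h3 : ((y i).natAbs : ℤ) = |y i| := Int.natCast_natAbs (y i)
    have hyabs : |y i| ≤ (Finset.univ.sup fun i => (y i).natAbs : ℕ) := by rw [← h3]; exact_mod_cast hyi
    have hR' : ((Finset.univ.sup fun i => (y i).natAbs : ℕ) : ℤ) + 1 ≤ R := by exact_mod_cast hR
    have hyab := abs_le.1 hyabs
    have hb' : b i < n := by
      have := Fintype.mem_piFinset.1 hb i
      simpa using this
    have hb0 : (0 : ℤ) ≤ (b i : ℤ) := by positivity
    have hb1 : ((b i : ℕ) : ℤ) + 1 ≤ n := by exact_mod_cast hb'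
    have hn1 : (1 : ℤ) ≤ n := by exact_mod_cast hn
    simp only [shiftF, toSite, Pi.add_apply, Pi.smul_apply, smul_eq_mul]
    constructor <;> nlinarith

end

end Summit.QuantumFields.BalabanUV.Beta.GAN24.WoodburyFibreLandauLimit
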